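/-
Copyright (c) 2026 the pub-hodgecm-mathlib formalisation cell (harness21).  Prover seat hodgecm-mathlib-K2E4-p14 (g6), Track B ∕ K2-LIT, h413 =
`stmt-HodgeConjecture-24833`, line `K2_E1_TraceFormulaBeta`, campaign «EIS-WHITTAKER-3», WAVE 2 capstone «W5₃-A» (dealer K2E1-plan (g5) 2026-09-04T08:11:34Z;
spec of record K2E1b-plan (g6) CENSUS `CENSUS-EIS-WHITTAKER-3` ba907189b20ed180 §5 row W5₃-A + CONVENTIONS memo W0₃ 2fdd2f7063acaab9); REPORT-FIRST 08:14:56Z.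
-/
import Summits.HodgeConjecture.HodgeConjecture.Theorems.K2E1SphericalEisensteinContinuationU2   -- ★ W5-A p858272 (K2E1-p09 g5): §1 helpers; imports ★ W4 p858248 `K2E1WhittakerSeriesConvergenceU2`
import HarnessLib

/-!
# K2·E1 — `K2E1SphericalEisensteinContinuationU3`: THE HYPOTHESIS-FIRST CAPSTONE OF «EIS-WHITTAKER-3» — MEROMORPHIC CONTINUATION OF THE SPHERICAL EISENSTEIN SERIES OF `U(2,1)_{L∕L⁺}`
# TO THE OPEN WINDOW `Re z > 1` WITH EXACTLY ONE POLE, SIMPLE, AT `z = 2ρ_H = 2`, RESIDUE A CONSTANT FUNCTION («(H4-b)₃-sph» MODULO ITS NAMED INPUTS)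

Track B ∕ K2-LIT, crux h413 = `stmt-HodgeConjecture-24833`, route of record `HCCMUnconditional`; cell `hodgecm-mathlib`, squad K2, ENGINE E1.  Prover seat `hodgecm-mathlib-K2E4-p14` (g6);
WAVE 2 capstone «W5₃-A» of the dealer K2E1-plan (g5) 08:11:34Z.  THEOREMS ONLY (no `def`, no `instance`, no notation, no named-fact hypothesis, no `sorry`); lane `--supports
stmt-HodgeConjecture-24833 --as helper` (count-neutral).  Closes no socket.  The `N = 3` twin of ★ W5-A `K2E1SphericalEisensteinContinuationU2` (p858272), written so that its core is
`N`-free and its two non-constant layers are abstract.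

THE MATHEMATICS [Garrett2018, §1.10–§1.12, §2.8–§2.11; Bump1997, §3.7; MoeglinWaldspurger1995, II.1.7 and IV.1; GelbartPiatetskiShapiro1984, §2].  On `U(J₃)` over the CM pair
`(L⁺, L)` the spherical Eisenstein series `E(z, g) = E(φ₀·H^z)(g)` has, for `Re z > 2`, the expansion along the Heisenberg unipotent radical (★ W1₃
`K2E1EisensteinMinusConstantTermPoissonU3.eisensteinSeriesU_sub_borelConstantTerm_eq_three` :159, two Poisson steps)
`E(z, g) = φ₀·(H(g)^z + c(z)·H(g)^{2−z}) + κ_J·Σ_{x₀ ∈ L} Σ_{η ∈ L⁺, η ≠ 0} J(z, x₀, η) + κ_W·Σ_{ξ ∈ L, ξ ≠ 0} W(z, ξ)`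
— the constant term (exponent `2 − z`: ★ `K2E1MaassSelbergCMThreeConstantTerms` :103), the FOURIER–JACOBI LAYER (non-zero Fourier coefficients along the centre line, summed over
`x₀ ∈ L`) and the WHITTAKER LAYER (non-zero Fourier coefficients of the centre average `Φ^Z` along `N∕Z ≅ 𝔸_L`).  The inputs of the continuation to an open `U ∋ 2` (of record:
`U = {Re z > 1}`) are: a meromorphic continuation `c̃` of `c` to `U` with a single (at most simple) pole at `z = 2` and `(z−2)·c̃(z) → r` [payer «W5₃-B», from ★ p858416
`K2E1IntertwiningScalarContinuationU3.exists_differentiableOn_sub_two_mul_scalar_cm`]; a Whittaker family `W(z, ξ)` holomorphic on `U` with ★ W4's exponential-times-polynomial bounds and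
compact finite support (★ W4 BYTES with `K := L`) [payers W2₃ ∕ W3₃ ∕ W4₃]; a Fourier–Jacobi family `J(z, x₀, η)` holomorphic on `U` with a locally-uniform-in-`z` summable majorant on
`L × L⁺` [payers J2₃ ∕ J3₃ ∕ J4₃]; and the expansion `hE` itself [W1₃ ★ + the identifications of W3₃ ∕ J3₃, plugged in «W5₃-FINAL»].  HYPOTHESIS-FIRST: `c̃`, `W`, `J`, `E` are FUNCTION
ARGUMENTS, their properties NAMED hypotheses, and the continued function is SPELLED OUT.
§1 **`continuation_of_constantTerm_add_holomorphic`** — THE `N`-FREE CORE: for ANY pole location `a ∈ U`, ANY holomorphic remainder `R` on `U` and ANY window predicate `P`,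
`Ẽ(z) := φ₀·(h^z + c̃(z)·h^{a−z}) + R(z)` is (a) holomorphic on `U ∖ {a}`, (a′) meromorphic on `U`, (b) `= E` where `hE` says so, (c) `(z−a)·Ẽ(z) → φ₀·r` (`h^{a−a} = 1`: the residue
is the CONSTANT `φ₀·Res_a c̃`, independent of `h = H(g)`).  ★ W5-A `spherical_continuation_of_inputs` is the case `a = 1`, `R = κ·Σ_{ξ≠0} W̃`, `P = (1 < Re ·)`.
§2 **`differentiableOn_tsum_indicator_of_majorant`** ∕ **`differentiableOn_tsum_tsum_indicator_of_majorant`** — INDEX-GENERIC holomorphy of a series `z ↦ Σ'_{ξ} 𝟙_{ξ≠0} W(z, ξ)` and of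
an ITERATED double series `z ↦ Σ'_{x₀} Σ'_{η} 𝟙_{η≠0} J(z, x₀, η)` from termwise holomorphy and a locally-uniform summable majorant on `ι` ∕ on `ι × ι'` (★ W4
`differentiableOn_tsum_of_locally_summable_norm`, once ∕ twice); the shapes are ★ W1₃ :159's verbatim (ABSTRACT-MAJORANT currency: no number field, no lattice).
§3 HEAD **`spherical_continuation_of_inputs_three`**: the `N = 3` instance in abstract-majorant currency for BOTH layers (symmetric, number-field-free) — pole at `2`, exponent `2 − z`,
window `2 < Re z` ⟹ (a) (a′) (b) (c) with residue `φ₀·r` («(H4-b)₃-sph: `L²_res ∩ sph = ℂ`» on the open window, modulo the named inputs); §3′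
**`spherical_continuation_of_inputs_three_of_exp_bounds`**: the same with the Whittaker layer in ★ W4's `(M, b, a, C_f)` BYTES (`K`-slot `:= L`, ★ W4
`summable_differentiableOn_tsum_of_exp_bounds` BY NAME) — the «W5₃-FINAL» plug takes whichever is shorter (dealer K2E1-plan (g5) 08:16:24Z «BOTH»).
HONEST LABEL: HC_CM is proved only modulo the 7 printed citations (2 remaining named inputs: hLiu418 = `stmt-HodgeConjecture-24832`, h413 = `stmt-HodgeConjecture-24833`) until rung 0
closes; this file asserts no named fact and closes no socket; it is CONDITIONAL BY CONSTRUCTION on the named inputs `hcmer hchol hcres hWhol hWmaj∕hWbd hJhol hJmaj hE` — when their payers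
land, «(H4-b)₃-sph» on the OPEN window `Re z > 1` is a theorem of the tree; no `L`-function continuation and no Mœglin–Waldspurger input is used on that window (the closed axis
`Re z = 1` is the recorded ceiling R7 and is NOT claimed).
References: [Garrett2018] P. Garrett, *Modern Analysis of Automorphic Forms by Example* 1 (2018), §1.10–§1.12, §2.8–§2.11 · [Bump1997] D. Bump, *Automorphic Forms and Representations*
(1997), §3.7 · [MoeglinWaldspurger1995] C. Mœglin, J.-L. Waldspurger, *Spectral Decomposition and Eisenstein Series* (1995), II.1.7, IV.1 · [GelbartPiatetskiShapiro1984] S. Gelbart,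
I. Piatetski-Shapiro, *Automorphic forms and L-functions for the unitary group*, LNM 1041 (1984), §2 (the `Z`-constant term and its expansion; cited for the shape of the two layers).
-/

set_option autoImplicit false
-- the mandated namespace repeats the single-problem summit's segment (`HodgeConjecture.HodgeConjecture`)
set_option linter.dupNamespace false

noncomputable section

open scoped Topology Classical
open NumberField IsDedekindDomain Set Filter Module
open Summit.HodgeConjecture.HodgeConjecture.Cruxes.H413.K2E1WhittakerSeriesConvergenceU2
open Summit.HodgeConjecture.HodgeConjecture.Cruxes.H413.K2E1SphericalEisensteinContinuationU2 (continuousAt_of_differentiableOn differentiable_const_cpow_of_pos)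

namespace Summit.HodgeConjecture.HodgeConjecture.Cruxes.H413.K2E1SphericalEisensteinContinuationU3

/-! ## §1 The `N`-free core: constant term with one simple pole at `a` plus a holomorphic remainder -/

/-- `z ↦ h^{a−z}` is entire for `h > 0` (the second constant-term exponent; `a = 2ρ_H`). [folklore] -/
theorem differentiable_const_cpow_const_sub_of_pos {h : ℝ} (hh : 0 < h) (a : ℂ) : Differentiable ℂ fun z : ℂ => ((h : ℝ) : ℂ) ^ (a - z) :=
  (differentiable_const_cpow_of_pos hh).comp ((differentiable_const a).sub differentiable_id)

/-- **THE `N`-FREE CONTINUATION CORE.**  Inputs: `U ⊆ ℂ` open, `a ∈ U` (the pole location `2ρ_H`); `c̃` meromorphic on `U`, holomorphic on `U ∖ {a}`, `(z−a)·c̃(z) → r` at `a`;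
`φ₀ : ℂ`, `h > 0`; a REMAINDER `R` holomorphic on `U` (the sum of all non-constant Fourier layers, already continued); a window predicate `P` and `E : ℂ → ℂ` with
`E = φ₀·(h^z + c̃(z)·h^{a−z}) + R` on `U ∩ P`.  Conclusions for `Ẽ(z) := φ₀·(h^z + c̃(z)·h^{a−z}) + R(z)`: (a) holomorphic on `U ∖ {a}`; (a′) meromorphic on `U`; (b) `= E` on `U ∩ P`;
(c) `(z−a)·Ẽ(z) → φ₀·r` (`z → a`, `z ≠ a`): the residue at the unique possible pole is the constant `φ₀·r`, independent of `h` (`h^{a−a} = 1`).  ★ W5-A `spherical_continuation_of_inputs`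
is the case `a = 1`, `R = κ·Σ_{ξ≠0} W̃(·, ξ)`, `P = (1 < Re ·)`. [cite: Garrett2018, §1.10–§1.12 and §2.8–§2.11] [cite: Bump1997, §3.7] [cite: MoeglinWaldspurger1995, IV.1] -/
theorem continuation_of_constantTerm_add_holomorphic {U : Set ℂ} (hU : IsOpen U) {a : ℂ} (haU : a ∈ U)
    {c : ℂ → ℂ} (hcmer : MeromorphicOn c U) (hchol : DifferentiableOn ℂ c (U \ {a})) {r : ℂ} (hcres : Tendsto (fun z : ℂ => (z - a) * c z) (𝓝[≠] a) (𝓝 r))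
    (φ₀ : ℂ) {h : ℝ} (hh : 0 < h) {R : ℂ → ℂ} (hR : DifferentiableOn ℂ R U) {P : ℂ → Prop} {E : ℂ → ℂ}
    (hE : ∀ z ∈ U, P z → E z = φ₀ * (((h : ℝ) : ℂ) ^ z + c z * ((h : ℝ) : ℂ) ^ (a - z)) + R z) :
    DifferentiableOn ℂ (fun z => φ₀ * (((h : ℝ) : ℂ) ^ z + c z * ((h : ℝ) : ℂ) ^ (a - z)) + R z) (U \ {a}) ∧
    MeromorphicOn (fun z => φ₀ * (((h : ℝ) : ℂ) ^ z + c z * ((h : ℝ) : ℂ) ^ (a - z)) + R z) U ∧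
    (∀ z ∈ U, P z → φ₀ * (((h : ℝ) : ℂ) ^ z + c z * ((h : ℝ) : ℂ) ^ (a - z)) + R z = E z) ∧
    Tendsto (fun z : ℂ => (z - a) * (φ₀ * (((h : ℝ) : ℂ) ^ z + c z * ((h : ℝ) : ℂ) ^ (a - z)) + R z)) (𝓝[≠] a) (𝓝 (φ₀ * r)) := by
  have hp1 : Differentiable ℂ fun z : ℂ => ((h : ℝ) : ℂ) ^ z := differentiable_const_cpow_of_pos hh
  have hp2 : Differentiable ℂ fun z : ℂ => ((h : ℝ) : ℂ) ^ (a - z) := differentiable_const_cpow_const_sub_of_pos hh a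
  -- (a) holomorphy off `z = a`
  have ha : DifferentiableOn ℂ (fun z => φ₀ * (((h : ℝ) : ℂ) ^ z + c z * ((h : ℝ) : ℂ) ^ (a - z)) + R z) (U \ {a}) :=
    ((hp1.differentiableOn.add (hchol.mul hp2.differentiableOn)).const_mul φ₀).add (hR.mono fun z hz => hz.1)
  -- (a′) meromorphy on `U`
  have ha' : MeromorphicOn (fun z => φ₀ * (((h : ℝ) : ℂ) ^ z + c z * ((h : ℝ) : ℂ) ^ (a - z)) + R z) U :=
    (((hp1.differentiableOn.analyticOnNhd hU).meromorphicOn.fun_add (hcmer.fun_mul (hp2.differentiableOn.analyticOnNhd hU).meromorphicOn)).const_smul φ₀ |>.congr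
      (fun z _ => by simp only [Pi.smul_apply, smul_eq_mul]) hU).fun_add (hR.analyticOnNhd hU).meromorphicOn
  refine ⟨ha, ha', fun z hz hPz => (hE z hz hPz).symm, ?_⟩
  -- (c) the residue at `z = a`
  have hRc : ContinuousAt R a := continuousAt_of_differentiableOn hU hR haU
  have hza : Tendsto (fun z : ℂ => z - a) (𝓝[≠] a) (𝓝 0) := by
    have h0 : Tendsto (fun z : ℂ => z - a) (𝓝 a) (𝓝 (a - a)) := (continuous_id.sub continuous_const).tendsto a
    rw [sub_self] at h0
    exact h0.mono_left nhdsWithin_le_nhds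
  have hc1 : Tendsto (fun z : ℂ => ((h : ℝ) : ℂ) ^ z) (𝓝[≠] a) (𝓝 (((h : ℝ) : ℂ) ^ a)) := (hp1 a).continuousAt.tendsto.mono_left nhdsWithin_le_nhds
  have hc2 : Tendsto (fun z : ℂ => ((h : ℝ) : ℂ) ^ (a - z)) (𝓝[≠] a) (𝓝 (((h : ℝ) : ℂ) ^ (a - a))) := (hp2 a).continuousAt.tendsto.mono_left nhdsWithin_le_nhds
  have hc3 : Tendsto R (𝓝[≠] a) (𝓝 (R a)) := hRc.tendsto.mono_left nhdsWithin_le_nhds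
  have hlim := ((((hza.mul hc1).const_mul φ₀).add ((hcres.mul hc2).const_mul φ₀)).add (hza.mul hc3))
  simp only [sub_self, Complex.cpow_zero, zero_mul, mul_zero, zero_add, add_zero, mul_one] at hlim
  refine hlim.congr fun z => ?_
  ring

/-! ## §2 Holomorphy of an iterated double series with a locally uniform summable majorant (the Fourier–Jacobi layer) -/

/-- **HOLOMORPHY OF THE SERIES** `z ↦ Σ'_{ξ : ι} 𝟙_{ξ ≠ 0}·W(z, ξ)`: `U` open, every `z ↦ W(z, ξ)` (`ξ ≠ 0`) holomorphic on `U`, and around every point of `U` a neighbourhood `V` with ONE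
summable majorant `u` on `ι`, `‖W(z, ξ)‖ ≤ u(ξ)` for `z ∈ V` ⟹ the series is holomorphic on `U` (★ W4 `differentiableOn_tsum_of_locally_summable_norm`; the indicator kills the `ξ = 0` term and
does not increase norms).  Index-generic (ABSTRACT-MAJORANT currency): at `N = 3` one takes `ι = L` (the Whittaker frequency `ξ`); ★ W4 `summable_differentiableOn_tsum_of_exp_bounds` is the
number-field instance with the `(M, b, a, C_f)` majorant. [cite: Bump1997, §3.7] [cite: Garrett2018, §2.8] -/
theorem differentiableOn_tsum_indicator_of_majorant {ι : Type*} [Zero ι] {U : Set ℂ} (hU : IsOpen U) {W : ℂ → ι → ℂ}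
    (hWhol : ∀ ξ : ι, ξ ≠ 0 → DifferentiableOn ℂ (fun z => W z ξ) U)
    (hWmaj : ∀ z₀ ∈ U, ∃ V ∈ 𝓝 z₀, ∃ u : ι → ℝ, Summable u ∧ ∀ z ∈ V, ∀ ξ : ι, ‖W z ξ‖ ≤ u ξ) :
    DifferentiableOn ℂ (fun z => ∑' ξ : ι, ({0}ᶜ : Set ι).indicator (fun ξ => W z ξ) ξ) U := by
  -- every summand `z ↦ 𝟙_{ξ≠0}·W(z, ξ)` is holomorphic on `U`
  have hin : ∀ ξ : ι, DifferentiableOn ℂ (fun z => ({0}ᶜ : Set ι).indicator (fun ξ => W z ξ) ξ) U := by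
    intro ξ
    by_cases hξ : ξ = 0
    · have h0 : ξ ∉ ({0}ᶜ : Set ι) := fun h => h hξ
      have hf : (fun z => ({0}ᶜ : Set ι).indicator (fun ξ => W z ξ) ξ) = fun _ => 0 := funext fun z => indicator_of_notMem h0 _
      rw [hf]
      exact differentiableOn_const 0
    · have hf : (fun z => ({0}ᶜ : Set ι).indicator (fun ξ => W z ξ) ξ) = fun z => W z ξ := funext fun z => indicator_of_mem (show ξ ∈ ({0}ᶜ : Set ι) from hξ) _
      rw [hf]
      exact hWhol ξ hξ
  refine differentiableOn_tsum_of_locally_summable_norm hU hin fun z hz => ?_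
  obtain ⟨V, hV, u, hu, hle⟩ := hWmaj z hz
  exact ⟨V, hV, u, hu, fun ξ w hw => (norm_indicator_le_norm_self _ _).trans (hle w hw ξ)⟩

/-- **HOLOMORPHY OF THE ITERATED DOUBLE SERIES** `z ↦ Σ'_{x₀ : ι} Σ'_{η : ι'} 𝟙_{η ≠ 0}·J(z, x₀, η)`: `U` open, every `z ↦ J(z, x₀, η)` (`η ≠ 0`) holomorphic on `U`, and around every point
of `U` a neighbourhood `V` with ONE summable majorant `u` on `ι × ι'`, `‖J(z, x₀, η)‖ ≤ u(x₀, η)` for `z ∈ V` ⟹ the iterated series is holomorphic on `U` (★ W4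
`differentiableOn_tsum_of_locally_summable_norm` for the inner sums with the slices `u(x₀, ·)`, then for the outer sum with the majorant `x₀ ↦ Σ'_η u(x₀, η)`).  Index-generic: no number field,
no lattice; at `N = 3` one takes `ι = L` (the parameter `x₀`), `ι' = L⁺` (the central frequency `η`). [cite: Bump1997, §3.7] [cite: Garrett2018, §2.8] -/
theorem differentiableOn_tsum_tsum_indicator_of_majorant {ι ι' : Type*} [Zero ι'] {U : Set ℂ} (hU : IsOpen U) {J : ℂ → ι → ι' → ℂ}
    (hJhol : ∀ (x₀ : ι) (η : ι'), η ≠ 0 → DifferentiableOn ℂ (fun z => J z x₀ η) U)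
    (hJmaj : ∀ z₀ ∈ U, ∃ V ∈ 𝓝 z₀, ∃ u : ι × ι' → ℝ, Summable u ∧ ∀ z ∈ V, ∀ (x₀ : ι) (η : ι'), ‖J z x₀ η‖ ≤ u (x₀, η)) :
    DifferentiableOn ℂ (fun z => ∑' x₀ : ι, ∑' η : ι', ({0}ᶜ : Set ι').indicator (J z x₀) η) U := by
  -- every summand `z ↦ 𝟙_{η≠0}·J(z, x₀, η)` is holomorphic on `U`
  have hin : ∀ (x₀ : ι) (η : ι'), DifferentiableOn ℂ (fun z => ({0}ᶜ : Set ι').indicator (J z x₀) η) U := by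
    intro x₀ η
    by_cases hη : η = 0
    · have h0 : η ∉ ({0}ᶜ : Set ι') := fun h => h hη
      have hf : (fun z => ({0}ᶜ : Set ι').indicator (J z x₀) η) = fun _ => 0 := funext fun z => indicator_of_notMem h0 _
      rw [hf]
      exact differentiableOn_const 0
    · have hf : (fun z => ({0}ᶜ : Set ι').indicator (J z x₀) η) = fun z => J z x₀ η := funext fun z => indicator_of_mem (show η ∈ ({0}ᶜ : Set ι') from hη) _
      rw [hf]
      exact hJhol x₀ η hη
  -- the indicator does not increase norms
  have hni : ∀ (z : ℂ) (x₀ : ι) (η : ι'), ‖({0}ᶜ : Set ι').indicator (J z x₀) η‖ ≤ ‖J z x₀ η‖ := fun z x₀ η => norm_indicator_le_norm_self _ _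
  -- the inner sums are holomorphic (majorant: the slice `u(x₀, ·)`)
  have hinner : ∀ x₀ : ι, DifferentiableOn ℂ (fun z => ∑' η : ι', ({0}ᶜ : Set ι').indicator (J z x₀) η) U := by
    intro x₀
    refine differentiableOn_tsum_of_locally_summable_norm hU (fun η => hin x₀ η) fun z hz => ?_
    obtain ⟨V, hV, u, hu, hle⟩ := hJmaj z hz
    exact ⟨V, hV, fun η => u (x₀, η), hu.prod_factor x₀, fun η w hw => (hni w x₀ η).trans (hle w hw x₀ η)⟩
  -- the outer sum (majorant: `x₀ ↦ Σ'_η u(x₀, η)`)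
  refine differentiableOn_tsum_of_locally_summable_norm hU hinner fun z hz => ?_
  obtain ⟨V, hV, u, hu, hle⟩ := hJmaj z hz
  refine ⟨V, hV, fun x₀ => ∑' η : ι', u (x₀, η), hu.prod, fun x₀ w hw => ?_⟩
  have h1 : ∀ η : ι', ‖({0}ᶜ : Set ι').indicator (J w x₀) η‖ ≤ u (x₀, η) := fun η => (hni w x₀ η).trans (hle w hw x₀ η)
  have hs : Summable fun η : ι' => ‖({0}ᶜ : Set ι').indicator (J w x₀) η‖ := .of_nonneg_of_le (fun _ => norm_nonneg _) h1 (hu.prod_factor x₀)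
  exact (norm_tsum_le_tsum_norm hs).trans (hs.tsum_le_tsum h1 (hu.prod_factor x₀))

/-! ## §3 The head: the `N = 3` instance — pole at `z = 2ρ_H = 2`, two layers, abstract-majorant currency -/

/-- **MEROMORPHIC CONTINUATION OF THE SPHERICAL EISENSTEIN SERIES OF `U(2,1)`, HYPOTHESIS-FIRST** («(H4-b)₃-sph» on the open window, modulo its named inputs; BOTH layers in
abstract-majorant currency — symmetric, number-field-free).  Inputs: `U ⊆ ℂ` open with `2 ∈ U` (of record `U = {Re z > 1}`); `c̃` meromorphic on `U`, holomorphic on `U ∖ {2}`,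
`(z−2)·c̃(z) → r` at `2` [W5₃-B]; a WHITTAKER family `W : ℂ → K → ℂ` (`K`-slot `:= L`) with every `z ↦ W(z, ξ)`, `ξ ≠ 0`, holomorphic on `U` and around every point of `U` ONE summable
majorant on `K` [W2₃, W3₃, W4₃ ∕ W-hWbd₃]; a FOURIER–JACOBI family `J : ℂ → K → K' → ℂ` (`K'`-slot `:= L⁺`) with every `z ↦ J(z, x₀, η)`, `η ≠ 0`, holomorphic on `U` and around every
point of `U` ONE summable majorant on `K × K'` [J2₃, J3₃, J4₃ ∕ J-hJbd₃]; `φ₀ κ_J κ_W : ℂ`, `h > 0`; `E : ℂ → ℂ` with the expansion `hE` on `U ∩ {Re z > 2}` in ★ W1₃ :159's shape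
(Fourier–Jacobi layer first, all `x₀`, `η ≠ 0`; Whittaker layer second, `ξ ≠ 0`; constant-term exponent `2 − z`) [W1₃ ★, W3₃, J3₃, «W5₃-FINAL»].  Conclusions for
`Ẽ(z) := φ₀·(h^z + c̃(z)·h^{2−z}) + κ_J·Σ'_{x₀} Σ'_{η≠0} J(z, x₀, η) + κ_W·Σ'_{ξ≠0} W(z, ξ)`: (a) holomorphic on `U ∖ {2}`; (a′) meromorphic on `U`; (b) `= E` on `U ∩ {Re z > 2}`;
(c) `(z−2)·Ẽ(z) → φ₀·r` (`z → 2`, `z ≠ 2`): the residue at the unique possible pole `z = 2ρ_H = 2` is the constant `φ₀·r`, independent of `h = H(g)`.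
[cite: Garrett2018, §1.10–§1.12 and §2.8–§2.11] [cite: Bump1997, §3.7] [cite: MoeglinWaldspurger1995, IV.1] [cite: GelbartPiatetskiShapiro1984, §2] -/
theorem spherical_continuation_of_inputs_three {K K' : Type*} [Zero K] [Zero K'] {U : Set ℂ} (hU : IsOpen U) (h2U : (2 : ℂ) ∈ U)
    {c : ℂ → ℂ} (hcmer : MeromorphicOn c U) (hchol : DifferentiableOn ℂ c (U \ {2})) {r : ℂ} (hcres : Tendsto (fun z : ℂ => (z - 2) * c z) (𝓝[≠] 2) (𝓝 r))
    {W : ℂ → K → ℂ} (hWhol : ∀ ξ : K, ξ ≠ 0 → DifferentiableOn ℂ (fun z => W z ξ) U)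
    (hWmaj : ∀ z₀ ∈ U, ∃ V ∈ 𝓝 z₀, ∃ u : K → ℝ, Summable u ∧ ∀ z ∈ V, ∀ ξ : K, ‖W z ξ‖ ≤ u ξ)
    {J : ℂ → K → K' → ℂ} (hJhol : ∀ (x₀ : K) (η : K'), η ≠ 0 → DifferentiableOn ℂ (fun z => J z x₀ η) U)
    (hJmaj : ∀ z₀ ∈ U, ∃ V ∈ 𝓝 z₀, ∃ u : K × K' → ℝ, Summable u ∧ ∀ z ∈ V, ∀ (x₀ : K) (η : K'), ‖J z x₀ η‖ ≤ u (x₀, η))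
    (φ₀ κJ κW : ℂ) {h : ℝ} (hh : 0 < h) {E : ℂ → ℂ}
    (hE : ∀ z ∈ U, 2 < z.re → E z = φ₀ * (((h : ℝ) : ℂ) ^ z + c z * ((h : ℝ) : ℂ) ^ (2 - z)) + κJ * ∑' x₀ : K, ∑' η : K', ({0}ᶜ : Set K').indicator (J z x₀) η + κW * ∑' ξ : K, ({0}ᶜ : Set K).indicator (fun ξ => W z ξ) ξ) :
    DifferentiableOn ℂ (fun z => φ₀ * (((h : ℝ) : ℂ) ^ z + c z * ((h : ℝ) : ℂ) ^ (2 - z)) + κJ * ∑' x₀ : K, ∑' η : K', ({0}ᶜ : Set K').indicator (J z x₀) η + κW * ∑' ξ : K, ({0}ᶜ : Set K).indicator (fun ξ => W z ξ) ξ) (U \ {2}) ∧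
    MeromorphicOn (fun z => φ₀ * (((h : ℝ) : ℂ) ^ z + c z * ((h : ℝ) : ℂ) ^ (2 - z)) + κJ * ∑' x₀ : K, ∑' η : K', ({0}ᶜ : Set K').indicator (J z x₀) η + κW * ∑' ξ : K, ({0}ᶜ : Set K).indicator (fun ξ => W z ξ) ξ) U ∧
    (∀ z ∈ U, 2 < z.re → φ₀ * (((h : ℝ) : ℂ) ^ z + c z * ((h : ℝ) : ℂ) ^ (2 - z)) + κJ * ∑' x₀ : K, ∑' η : K', ({0}ᶜ : Set K').indicator (J z x₀) η + κW * ∑' ξ : K, ({0}ᶜ : Set K).indicator (fun ξ => W z ξ) ξ = E z) ∧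
    Tendsto (fun z : ℂ => (z - 2) * (φ₀ * (((h : ℝ) : ℂ) ^ z + c z * ((h : ℝ) : ℂ) ^ (2 - z)) + κJ * ∑' x₀ : K, ∑' η : K', ({0}ᶜ : Set K').indicator (J z x₀) η + κW * ∑' ξ : K, ({0}ᶜ : Set K).indicator (fun ξ => W z ξ) ξ)) (𝓝[≠] 2) (𝓝 (φ₀ * r)) := by
  -- both layers are holomorphic on `U` (§2), hence so is the remainder `R := κ_J·S_J + κ_W·S_W`; then §1 at `a = 2`
  have hSW := differentiableOn_tsum_indicator_of_majorant hU hWhol hWmaj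
  have hSJ := differentiableOn_tsum_tsum_indicator_of_majorant hU hJhol hJmaj
  have hR : DifferentiableOn ℂ (fun z => κJ * ∑' x₀ : K, ∑' η : K', ({0}ᶜ : Set K').indicator (J z x₀) η + κW * ∑' ξ : K, ({0}ᶜ : Set K).indicator (fun ξ => W z ξ) ξ) U :=
    (hSJ.const_mul κJ).add (hSW.const_mul κW)
  have h := continuation_of_constantTerm_add_holomorphic hU h2U hcmer hchol hcres φ₀ hh hR (P := fun z => 2 < z.re) (E := E) (fun z hz hPz => by rw [hE z hz hPz, add_assoc])
  simp only [← add_assoc] at h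
  exact h

/-! ## §3′ The same head with the Whittaker layer in ★ W4's `(M, b, a, C_f)` bytes -/

/-- **MEROMORPHIC CONTINUATION OF THE SPHERICAL EISENSTEIN SERIES OF `U(2,1)`, HYPOTHESIS-FIRST — ★ W4-BYTES EDITION**: §3 `spherical_continuation_of_inputs_three` with the Whittaker
layer's majorant letter replaced by ★ W4's local bounds `‖W(z, ξ)‖ ≤ M·e^{−b‖ξ_∞‖}·(1+‖ξ_∞‖)^a` with ONE compact `ξ_f`-support over a number field `K` (`K`-slot `:= L`; BYTES of ★ W4
`summable_differentiableOn_tsum_of_exp_bounds` :213–:218, which sums them BY NAME); the Fourier–Jacobi layer stays in abstract-majorant currency [J4₃ ∕ J-hJbd₃].  Same conclusions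
(a) (a′) (b) (c), pole at `z = 2`, residue `φ₀·r`. [cite: Garrett2018, §1.10–§1.12 and §2.8–§2.11] [cite: Bump1997, §3.7] [cite: MoeglinWaldspurger1995, IV.1] [cite: WeilBNT1967, Ch. IV §2] -/
theorem spherical_continuation_of_inputs_three_of_exp_bounds (K : Type) [Field K] [NumberField K] {K' : Type*} [Zero K'] {U : Set ℂ} (hU : IsOpen U) (h2U : (2 : ℂ) ∈ U)
    {c : ℂ → ℂ} (hcmer : MeromorphicOn c U) (hchol : DifferentiableOn ℂ c (U \ {2})) {r : ℂ} (hcres : Tendsto (fun z : ℂ => (z - 2) * c z) (𝓝[≠] 2) (𝓝 r))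
    {W : ℂ → K → ℂ} (hWhol : ∀ ξ : K, ξ ≠ 0 → DifferentiableOn ℂ (fun z => W z ξ) U)
    (hWbd : ∀ z₀ ∈ U, ∃ V ∈ 𝓝 z₀, ∃ (M b a : ℝ) (Cf : Set (FiniteAdeleRing (𝓞 K) K)), 0 ≤ M ∧ 0 < b ∧ IsCompact Cf ∧
      ∀ z ∈ V, ∀ ξ : K,
        ‖W z ξ‖ ≤ M * Real.exp (-(b * ‖InfiniteAdeleRing.ringEquiv_mixedSpace K (algebraMap K (AdeleRing (𝓞 K) K) ξ).1‖)) *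
          (1 + ‖InfiniteAdeleRing.ringEquiv_mixedSpace K (algebraMap K (AdeleRing (𝓞 K) K) ξ).1‖) ^ a ∧
        ((algebraMap K (AdeleRing (𝓞 K) K) ξ).2 ∉ Cf → W z ξ = 0))
    {J : ℂ → K → K' → ℂ} (hJhol : ∀ (x₀ : K) (η : K'), η ≠ 0 → DifferentiableOn ℂ (fun z => J z x₀ η) U)
    (hJmaj : ∀ z₀ ∈ U, ∃ V ∈ 𝓝 z₀, ∃ u : K × K' → ℝ, Summable u ∧ ∀ z ∈ V, ∀ (x₀ : K) (η : K'), ‖J z x₀ η‖ ≤ u (x₀, η))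
    (φ₀ κJ κW : ℂ) {h : ℝ} (hh : 0 < h) {E : ℂ → ℂ}
    (hE : ∀ z ∈ U, 2 < z.re → E z = φ₀ * (((h : ℝ) : ℂ) ^ z + c z * ((h : ℝ) : ℂ) ^ (2 - z)) + κJ * ∑' x₀ : K, ∑' η : K', ({0}ᶜ : Set K').indicator (J z x₀) η + κW * ∑' ξ : K, ({0}ᶜ : Set K).indicator (fun ξ => W z ξ) ξ) :
    DifferentiableOn ℂ (fun z => φ₀ * (((h : ℝ) : ℂ) ^ z + c z * ((h : ℝ) : ℂ) ^ (2 - z)) + κJ * ∑' x₀ : K, ∑' η : K', ({0}ᶜ : Set K').indicator (J z x₀) η + κW * ∑' ξ : K, ({0}ᶜ : Set K).indicator (fun ξ => W z ξ) ξ) (U \ {2}) ∧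
    MeromorphicOn (fun z => φ₀ * (((h : ℝ) : ℂ) ^ z + c z * ((h : ℝ) : ℂ) ^ (2 - z)) + κJ * ∑' x₀ : K, ∑' η : K', ({0}ᶜ : Set K').indicator (J z x₀) η + κW * ∑' ξ : K, ({0}ᶜ : Set K).indicator (fun ξ => W z ξ) ξ) U ∧
    (∀ z ∈ U, 2 < z.re → φ₀ * (((h : ℝ) : ℂ) ^ z + c z * ((h : ℝ) : ℂ) ^ (2 - z)) + κJ * ∑' x₀ : K, ∑' η : K', ({0}ᶜ : Set K').indicator (J z x₀) η + κW * ∑' ξ : K, ({0}ᶜ : Set K).indicator (fun ξ => W z ξ) ξ = E z) ∧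
    Tendsto (fun z : ℂ => (z - 2) * (φ₀ * (((h : ℝ) : ℂ) ^ z + c z * ((h : ℝ) : ℂ) ^ (2 - z)) + κJ * ∑' x₀ : K, ∑' η : K', ({0}ᶜ : Set K').indicator (J z x₀) η + κW * ∑' ξ : K, ({0}ᶜ : Set K).indicator (fun ξ => W z ξ) ξ)) (𝓝[≠] 2) (𝓝 (φ₀ * r)) := by
  -- the Whittaker layer is holomorphic on `U` (★ W4 BY NAME, `K`-slot) and so is the Fourier–Jacobi layer (§2); then §1 at `a = 2`
  obtain ⟨-, -, hSW⟩ := summable_differentiableOn_tsum_of_exp_bounds K hU hWhol hWbd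
  have hSJ := differentiableOn_tsum_tsum_indicator_of_majorant hU hJhol hJmaj
  have hR : DifferentiableOn ℂ (fun z => κJ * ∑' x₀ : K, ∑' η : K', ({0}ᶜ : Set K').indicator (J z x₀) η + κW * ∑' ξ : K, ({0}ᶜ : Set K).indicator (fun ξ => W z ξ) ξ) U :=
    (hSJ.const_mul κJ).add (hSW.const_mul κW)
  have h := continuation_of_constantTerm_add_holomorphic hU h2U hcmer hchol hcres φ₀ hh hR (P := fun z => 2 < z.re) (E := E) (fun z hz hPz => by rw [hE z hz hPz, add_assoc])
  simp only [← add_assoc] at h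
  exact h

end Summit.HodgeConjecture.HodgeConjecture.Cruxes.H413.K2E1SphericalEisensteinContinuationU3

end
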